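import Summits.MatrixMultiplication.MatrixMultiplication.Theorems.AsymptoticRankCWBPerm3Form
import Summits.MatrixMultiplication.MatrixMultiplication.Theorems.AsymptoticRankCWGlueDet3Omega

/-!
# `BThesis` from the skew sibling: `BDet3AsymptoticRank ∧ (R̃(T_cw,2) ≤ R̃(ε)) → BThesis`
(route `MatrixMultiplication/AsymptoticRankCW`; crux-strategist split of the deciding crux `BThesis`,
stmt-MatrixMultiplication-0588, through the route's own rank-3 crux `BDet3AsymptoticRank`, stmt-0591)

`ε` is the Levi-Civita tensor written inline exactly as in `BDet3AsymptoticRank` (`≅ T_skewcw,2`,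
`ε ⊠ ε ≅ det₃`, Conner–Gesmundo–Landsberg–Ventura 2022 Lemma 2.4). From `R̃(ε ⊠ ε) = 9` the proved growth
lemma `isBigO_tensorRank_kroneckerPow_of_asymptoticRank_sq_le` (GlueDet3Omega file) and
`asymptoticRank_le_of_forall_isBigO` (BPerm3Form file) give `R̃(ε) ≤ 3`; the domination hypothesis
`R̃(T_cw,2) ≤ R̃(ε)` (new piece `BSkewDominatesCw`) gives `R̃(T_cw,2) ≤ 3`, and `isBigO_of_asymptoticRank_le`
is the growth form `BThesis` (its inline Kronecker power is `kroneckerPow (cwTensor ℂ 2) N` by `rfl`).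
Sorry-free; standard axioms.
-/

set_option linter.dupNamespace false

noncomputable section

namespace Summit.MatrixMultiplication.MatrixMultiplication.Theorems

open Literature.Computability.AlgebraicComplexity

/-- **Split glue** `BDet3AsymptoticRank → BSkewDominatesCw → BThesis`: ARC at the skew sibling plus
asymptotic domination of `T_cw,2` by it give `R̃(T_cw,2) = 3`. [folklore] -/
theorem bThesis_of_skew_subs
    (h₁ : Summit.MatrixMultiplication.MatrixMultiplication.Theses.AsymptoticRankCW.BDet3AsymptoticRank)
    (h₂ : asymptoticRank (cwTensor ℂ 2) ≤
      asymptoticRank (fun a b c : Fin 3 => (if b = a + 1 ∧ c = a + 2 then (1 : ℂ) else 0) -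
        (if b = a + 2 ∧ c = a + 1 then 1 else 0))) :
    Summit.MatrixMultiplication.MatrixMultiplication.Theses.AsymptoticRankCW.BThesis := by
  unfold Summit.MatrixMultiplication.MatrixMultiplication.Theses.AsymptoticRankCW.BThesis
  unfold Summit.MatrixMultiplication.MatrixMultiplication.Theses.AsymptoticRankCW.BDet3AsymptoticRank at h₁
  have h9 : asymptoticRank (kroneckerTensor
      (fun a b c : Fin 3 => (if b = a + 1 ∧ c = a + 2 then (1 : ℂ) else 0) -
        (if b = a + 2 ∧ c = a + 1 then 1 else 0))
      (fun a b c : Fin 3 => (if b = a + 1 ∧ c = a + 2 then (1 : ℂ) else 0) -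
        (if b = a + 2 ∧ c = a + 1 then 1 else 0))) ≤ (3 : ℝ) ^ 2 := by
    rw [h₁]; norm_num
  have hgrowth := isBigO_tensorRank_kroneckerPow_of_asymptoticRank_sq_le _ 3 (by norm_num) h9
  have h3 := asymptoticRank_le_of_forall_isBigO _ (by norm_num) hgrowth
  intro ε hε
  exact isBigO_of_asymptoticRank_le (cwTensor ℂ 2) (by norm_num) (h₂.trans h3) hε

end Summit.MatrixMultiplication.MatrixMultiplication.Theorems

end
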